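import Mathlib.Analysis.SpecialFunctions.Trigonometric.Bounds
import Literature.MathematicalPhysics.QuantumLattice.DuhamelTwoPointProofs
import Literature.MathematicalPhysics.QuantumFieldTheory.TiltedExponentMorseBounds
import HarnessLib

/-!
# Faddeev–Popov positivity at a minimum of the lattice Coulomb-gauge functional

Support file (everything PROVED, no definition, no named fact) for Zwanziger's Gribov-region bounds
in the minimal lattice Coulomb / Landau gauge (route `ConvexGribovBody` of `QuantumFields/YangMills`,
crux `CovarianceBound`).

## Content

Fix finitely many "links" `e : E` with endpoints `s e, t e : V`, unitary link variables
`W e ∈ U(N)` and, for a family of generators `ω : V → M_N(ℂ)`, the one-parameter family of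
gauge-functional values

  `F(τ) = ∑ₑ Re tr( exp(τ ω_{s e}) · W_e · exp(-τ ω_{t e}) )`

(the lattice Coulomb/Landau gauge-fixing functional `∑ Re tr (U^g)_e` along the gauge
transformations `g_x(τ) = exp(τ ω_x)`). We prove:

* `hasDerivAt_re_trace_exp_conj` : `d/dτ Re tr(e^{τP} W e^{-τQ}) = Re tr(e^{τP}(PW - WQ)e^{-τQ})`;
* `sum_re_trace_second_variation_nonpos` : if `F(τ) ≤ F(0)` for all `τ` (a maximum of the gauge
  functional, i.e. a minimum of `-F`: the configuration lies in the Gribov region), then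
  `F''(0) = ∑ₑ Re tr(ω_s² W - 2 ω_s W ω_t + W ω_t²) ≤ 0` — **positivity of the lattice
  Faddeev–Popov operator** (second-derivative test, tree `Matrix.deriv2_nonpos_of_forall_le`);
* `re_trace_second_variation_smul_add` : the explicit quadratic form for the two-plane-wave family
  `ω_x = φ(x) X + ψ(x) Y`;
* `abs_sum_pairing_le` : the resulting **FP inequality**
  `|∑ₑ (φ(t e)ψ(s e) - ψ(t e)φ(s e)) Re tr(W_e [X, Y])| ≤ √N (‖X²‖ + ‖Y²‖ + ‖XY + YX‖) ∑ₑ ((Δₑφ)² + (Δₑψ)²)`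
  (Frobenius norms; `Δₑφ = φ(s e) - φ(t e)`), obtained from `F'' ≤ 0` for `(φ, ψ)` and `(φ, -ψ)`;
* the re-indexing of the time-zero spatial edges of the torus `Edge 4 L` by
  `(Fin 3 → ZMod L) × Fin 3` (`sum_edge_slice_eq`); the plane-wave extraction of a Fourier mode
  from the FP inequality is the companion file `GribovSupportPlaneWaves.lean`.

Sources: D. Zwanziger, Nucl. Phys. B 364 (1991) 127 and Nucl. Phys. B 412 (1994) 657, Sect. 2
(minimal lattice Coulomb gauge; the lattice Faddeev–Popov operator is the Hessian of the minimising
functional, non-negative at a minimum = the Gribov region); G. Dell'Antonio, D. Zwanziger,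
Commun. Math. Phys. 138 (1991) 291.

## Design notes

No norm instance on matrices is global: the calculus runs in Mathlib's scoped Frobenius normed
algebra (`Matrix.Norms.Frobenius`), statements carry `frobNorm` (tree
`LatticeGaugeDobrushinPoincare.lean`). Real parameters act on complex matrices through Mathlib's
real module structure on `ℂ`.
-/

noncomputable section

open NormedSpace Filter
open scoped Matrix ComplexConjugate Topology BigOperators

namespace Literature.MathematicalPhysics.QuantumFieldTheory

namespace CoulombFP

/-! ### Calculus: first and second variation of `Re tr(e^{τP} W e^{-τQ})` -/

section Calculus

variable {N : ℕ}

set_option backward.isDefEq.respectTransparency false in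
open scoped Matrix.Norms.Frobenius in
/-- `d/dτ Re tr(e^{τP} W e^{-τQ}) = Re tr(e^{τP} (P W - W Q) e^{-τQ})` (product rule,
`d/dτ e^{τP} = e^{τP} P`, `d/dτ e^{-τQ} = -Q e^{-τQ}`). [folklore] -/
theorem hasDerivAt_re_trace_exp_conj (P W Q : Matrix (Fin N) (Fin N) ℂ) (τ : ℝ) :
    HasDerivAt (fun u : ℝ => (exp (u • P) * W * exp (u • -Q)).trace.re)
      ((exp (τ • P) * (P * W - W * Q) * exp (τ • -Q)).trace.re) τ := by
  have h1 : HasDerivAt (fun u : ℝ => exp (u • P)) (exp (τ • P) * P) τ :=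
    hasDerivAt_exp_smul_const (𝕂 := ℝ) P τ
  have h2 : HasDerivAt (fun u : ℝ => exp (u • -Q)) (exp (τ • -Q) * -Q) τ :=
    hasDerivAt_exp_smul_const (𝕂 := ℝ) (-Q) τ
  have h3 := (h1.mul_const W).mul h2
  set L : Matrix (Fin N) (Fin N) ℂ →L[ℝ] ℂ :=
    LinearMap.toContinuousLinearMap ((Matrix.traceLinearMap (Fin N) ℂ ℂ).restrictScalars ℝ) with hL
  have hLapply : ∀ M : Matrix (Fin N) (Fin N) ℂ, L M = M.trace := fun M => rfl
  have h4 := Complex.reCLM.hasFDerivAt.comp_hasDerivAt τ (L.hasFDerivAt.comp_hasDerivAt τ h3)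
  have hcomm : exp (τ • -Q) * -Q = -Q * exp (τ • -Q) :=
    (((Commute.refl (-Q)).smul_left τ).exp_left).eq
  have h5 : HasDerivAt (fun u : ℝ => (exp (u • P) * W * exp (u • -Q)).trace.re)
      (Complex.reCLM (L (exp (τ • P) * P * W * exp (τ • -Q) +
        exp (τ • P) * W * (exp (τ • -Q) * -Q)))) τ := h4
  refine h5.congr_deriv ?_
  rw [Complex.reCLM_apply, hLapply, hcomm]
  congr 2
  simp only [mul_sub, sub_mul, mul_neg, neg_mul, mul_assoc]
  abel

/-- **Positivity of the lattice Faddeev–Popov operator at a minimum of the gauge functional.**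
If `F(τ) = ∑ₑ Re tr(e^{τ ω_{s e}} W_e e^{-τ ω_{t e}})` satisfies `F(τ) ≤ F(0)` for all real `τ`,
then `F''(0) = ∑ₑ Re tr(ω_s (ω_s W - W ω_t) - (ω_s W - W ω_t) ω_t) ≤ 0`.
[cite: Zwanziger1994, Sect. 2] -/
theorem sum_re_trace_second_variation_nonpos {V E : Type*} [Fintype E] (s t : E → V)
    (W : E → Matrix (Fin N) (Fin N) ℂ) (ω : V → Matrix (Fin N) (Fin N) ℂ)
    (hmax : ∀ τ : ℝ, ∑ e, (exp (τ • ω (s e)) * W e * exp (τ • -ω (t e))).trace.re ≤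
      ∑ e, (W e).trace.re) :
    ∑ e, (ω (s e) * (ω (s e) * W e - W e * ω (t e)) -
      (ω (s e) * W e - W e * ω (t e)) * ω (t e)).trace.re ≤ 0 := by
  have hg : ∀ τ : ℝ, HasDerivAt
      (fun u : ℝ => ∑ e, (exp (u • ω (s e)) * W e * exp (u • -ω (t e))).trace.re)
      (∑ e, (exp (τ • ω (s e)) * (ω (s e) * W e - W e * ω (t e)) *
        exp (τ • -ω (t e))).trace.re) τ := fun τ =>
    HasDerivAt.fun_sum fun e _ => hasDerivAt_re_trace_exp_conj (ω (s e)) (W e) (ω (t e)) τ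
  have hg' : HasDerivAt
      (fun u : ℝ => ∑ e, (exp (u • ω (s e)) * (ω (s e) * W e - W e * ω (t e)) *
        exp (u • -ω (t e))).trace.re)
      (∑ e, (exp ((0 : ℝ) • ω (s e)) * (ω (s e) * (ω (s e) * W e - W e * ω (t e)) -
        (ω (s e) * W e - W e * ω (t e)) * ω (t e)) * exp ((0 : ℝ) • -ω (t e))).trace.re) 0 :=
    HasDerivAt.fun_sum fun e _ => hasDerivAt_re_trace_exp_conj (ω (s e)) _ (ω (t e)) 0
  have hle : ∀ τ : ℝ,
      (fun u : ℝ => ∑ e, (exp (u • ω (s e)) * W e * exp (u • -ω (t e))).trace.re) τ ≤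
      (fun u : ℝ => ∑ e, (exp (u • ω (s e)) * W e * exp (u • -ω (t e))).trace.re) 0 := by
    intro τ
    simp only [zero_smul, exp_zero, one_mul, mul_one]
    exact hmax τ
  have h := Matrix.deriv2_nonpos_of_forall_le hle hg hg'
  simpa only [zero_smul, exp_zero, one_mul, mul_one] using h

end Calculus

/-! ### Algebra: the quadratic form of the two-wave family `ω = φ X + ψ Y` -/

section Algebra

variable {N : ℕ}

/-- Cyclicity: `tr(P(PW - WQ) - (PW - WQ)Q) = tr(W P²) - 2 tr(W Q P) + tr(W Q²)`. [folklore] -/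
theorem trace_second_variation (P W Q : Matrix (Fin N) (Fin N) ℂ) :
    (P * (P * W - W * Q) - (P * W - W * Q) * Q).trace =
      (W * (P * P)).trace - (W * (Q * P)).trace - (W * (Q * P)).trace + (W * (Q * Q)).trace := by
  have h1 : (P * (P * W)).trace = (W * (P * P)).trace := by
    rw [← Matrix.mul_assoc, Matrix.trace_mul_comm]
  have h2 : (P * (W * Q)).trace = (W * (Q * P)).trace := by
    rw [Matrix.trace_mul_comm, Matrix.mul_assoc]
  have h3 : (P * W * Q).trace = (W * (Q * P)).trace := by
    rw [Matrix.trace_mul_comm, ← Matrix.mul_assoc, Matrix.trace_mul_comm]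
  have h4 : (W * Q * Q).trace = (W * (Q * Q)).trace := by rw [Matrix.mul_assoc]
  rw [Matrix.mul_sub, Matrix.sub_mul, Matrix.trace_sub, Matrix.trace_sub, Matrix.trace_sub, h1, h2,
    h3, h4]
  ring

/-- Bilinear expansion of `Re tr(W (aX + bY)(cX + dY))`. [folklore] -/
theorem re_trace_mul_smul_add_mul_smul_add (W X Y : Matrix (Fin N) (Fin N) ℂ) (a b c d : ℝ) :
    (W * ((a • X + b • Y) * (c • X + d • Y))).trace.re =
      a * c * (W * (X * X)).trace.re + a * d * (W * (X * Y)).trace.re +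
        b * c * (W * (Y * X)).trace.re + b * d * (W * (Y * Y)).trace.re := by
  simp only [add_mul, mul_add, smul_mul_assoc, mul_smul_comm, Matrix.trace_add,
    Matrix.trace_smul, Complex.add_re, Complex.smul_re, smul_eq_mul]
  ring

/-- **The second variation of the gauge functional along `ω = φ X + ψ Y`, edge by edge.** With
`P = f₁X + g₁Y` (at `s e`) and `Q = f₂X + g₂Y` (at `t e`):
`Re tr(P(PW - WQ) - (PW - WQ)Q) = (Δf)² Re tr(WX²) + (Δg)² Re tr(WY²) + Δf Δg Re tr(W(XY + YX))
  - (f₂g₁ - g₂f₁) Re tr(W[X, Y])`, `Δf = f₁ - f₂`, `Δg = g₁ - g₂`. [folklore] -/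
theorem re_trace_second_variation_smul_add (W X Y : Matrix (Fin N) (Fin N) ℂ) (f₁ g₁ f₂ g₂ : ℝ) :
    ((f₁ • X + g₁ • Y) * ((f₁ • X + g₁ • Y) * W - W * (f₂ • X + g₂ • Y)) -
        ((f₁ • X + g₁ • Y) * W - W * (f₂ • X + g₂ • Y)) * (f₂ • X + g₂ • Y)).trace.re =
      (f₁ - f₂) ^ 2 * (W * (X * X)).trace.re + (g₁ - g₂) ^ 2 * (W * (Y * Y)).trace.re +
        (f₁ - f₂) * (g₁ - g₂) * (W * (X * Y + Y * X)).trace.re -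
        (f₂ * g₁ - g₂ * f₁) * (W * (X * Y - Y * X)).trace.re := by
  rw [trace_second_variation]
  simp only [Complex.sub_re, Complex.add_re]
  rw [re_trace_mul_smul_add_mul_smul_add, re_trace_mul_smul_add_mul_smul_add,
    re_trace_mul_smul_add_mul_smul_add, Matrix.mul_add, Matrix.trace_add, Complex.add_re,
    Matrix.mul_sub, Matrix.trace_sub, Complex.sub_re]
  ring

/-- **The Faddeev–Popov inequality at a minimum of the lattice Coulomb-gauge functional**
(Zwanziger's Gribov-region bound, raw form). For unitary link variables `W_e` and generators
`X, Y`, if the gauge functional is maximal at `τ = 0` along both families `ω = φX ± ψY`, then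
`|∑ₑ (φ(t e)ψ(s e) - ψ(t e)φ(s e)) Re tr(W_e [X,Y])|
  ≤ √N (‖X²‖_F + ‖Y²‖_F + ‖XY + YX‖_F) ∑ₑ ((φ(s e) - φ(t e))² + (ψ(s e) - ψ(t e))²)`.
[cite: Zwanziger1994, Sect. 2] -/
theorem abs_sum_pairing_le {V E : Type*} [Fintype E] (s t : E → V)
    (W : E → Matrix (Fin N) (Fin N) ℂ) (hW : ∀ e, W e ∈ Matrix.unitaryGroup (Fin N) ℂ)
    (X Y : Matrix (Fin N) (Fin N) ℂ) (φ ψ : V → ℝ)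
    (hmaxp : ∀ τ : ℝ, ∑ e, (exp (τ • (φ (s e) • X + ψ (s e) • Y)) * W e *
        exp (τ • -(φ (t e) • X + ψ (t e) • Y))).trace.re ≤ ∑ e, (W e).trace.re)
    (hmaxm : ∀ τ : ℝ, ∑ e, (exp (τ • (φ (s e) • X + (-ψ (s e)) • Y)) * W e *
        exp (τ • -(φ (t e) • X + (-ψ (t e)) • Y))).trace.re ≤ ∑ e, (W e).trace.re) :
    |∑ e, (φ (t e) * ψ (s e) - ψ (t e) * φ (s e)) * (W e * (X * Y - Y * X)).trace.re| ≤
      Real.sqrt N * (frobNorm (X * X) + frobNorm (Y * Y) + frobNorm (X * Y + Y * X)) *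
        ∑ e, ((φ (s e) - φ (t e)) ^ 2 + (ψ (s e) - ψ (t e)) ^ 2) := by
  have hp := sum_re_trace_second_variation_nonpos s t W (fun v => φ v • X + ψ v • Y) hmaxp
  have hm := sum_re_trace_second_variation_nonpos s t W (fun v => φ v • X + (-ψ v) • Y) hmaxm
  simp only [re_trace_second_variation_smul_add] at hp hm
  set K : ℝ := Real.sqrt N * (frobNorm (X * X) + frobNorm (Y * Y) + frobNorm (X * Y + Y * X))
    with hK
  -- per-edge trace bounds from unitarity
  have htr : ∀ (e : E) (M : Matrix (Fin N) (Fin N) ℂ),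
      |(W e * M).trace.re| ≤ Real.sqrt N * frobNorm M := fun e M => by
    have h := abs_re_trace_mul_le (W e) M
    rwa [OneLinkLaplace.frobNorm_of_mem_unitaryGroup (hW e)] at h
  -- abbreviations
  set A : E → ℝ := fun e => (φ (s e) - φ (t e)) ^ 2 * (W e * (X * X)).trace.re +
    (ψ (s e) - ψ (t e)) ^ 2 * (W e * (Y * Y)).trace.re with hA
  set B : E → ℝ := fun e =>
    (φ (s e) - φ (t e)) * (ψ (s e) - ψ (t e)) * (W e * (X * Y + Y * X)).trace.re with hB
  set C : E → ℝ := fun e =>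
    (φ (t e) * ψ (s e) - ψ (t e) * φ (s e)) * (W e * (X * Y - Y * X)).trace.re with hC
  have hpt : ∀ e, |A e| + |B e| ≤ K * ((φ (s e) - φ (t e)) ^ 2 + (ψ (s e) - ψ (t e)) ^ 2) := by
    intro e
    have hx := htr e (X * X)
    have hy := htr e (Y * Y)
    have hu := htr e (X * Y + Y * X)
    have hab : 2 * |(φ (s e) - φ (t e)) * (ψ (s e) - ψ (t e))| ≤
        (φ (s e) - φ (t e)) ^ 2 + (ψ (s e) - ψ (t e)) ^ 2 := by
      rw [abs_mul]
      nlinarith [sq_nonneg (|φ (s e) - φ (t e)| - |ψ (s e) - ψ (t e)|),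
        sq_abs (φ (s e) - φ (t e)), sq_abs (ψ (s e) - ψ (t e))]
    have hA' : |A e| ≤ (φ (s e) - φ (t e)) ^ 2 * (Real.sqrt N * frobNorm (X * X)) +
        (ψ (s e) - ψ (t e)) ^ 2 * (Real.sqrt N * frobNorm (Y * Y)) := by
      refine (abs_add_le _ _).trans ?_
      rw [abs_mul, abs_mul, abs_of_nonneg (sq_nonneg (φ (s e) - φ (t e))),
        abs_of_nonneg (sq_nonneg (ψ (s e) - ψ (t e)))]
      exact add_le_add (mul_le_mul_of_nonneg_left hx (sq_nonneg _))
        (mul_le_mul_of_nonneg_left hy (sq_nonneg _))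
    have hB' : |B e| ≤ ((φ (s e) - φ (t e)) ^ 2 + (ψ (s e) - ψ (t e)) ^ 2) / 2 *
        (Real.sqrt N * frobNorm (X * Y + Y * X)) := by
      rw [hB]
      dsimp only
      rw [abs_mul]
      exact mul_le_mul (by linarith) hu (abs_nonneg _) (by positivity)
    have hXX : 0 ≤ frobNorm (X * X) := frobNorm_nonneg _
    have hYY : 0 ≤ frobNorm (Y * Y) := frobNorm_nonneg _
    have hXY : 0 ≤ frobNorm (X * Y + Y * X) := frobNorm_nonneg _
    have hsq : 0 ≤ Real.sqrt N := Real.sqrt_nonneg _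
    have h1 : 0 ≤ (φ (s e) - φ (t e)) ^ 2 := sq_nonneg _
    have h2 : 0 ≤ (ψ (s e) - ψ (t e)) ^ 2 := sq_nonneg _
    rw [hK]
    nlinarith [mul_nonneg hsq hXX, mul_nonneg hsq hYY, mul_nonneg hsq hXY,
      mul_nonneg h1 (mul_nonneg hsq hYY), mul_nonneg h2 (mul_nonneg hsq hXX),
      mul_nonneg h1 (mul_nonneg hsq hXY), mul_nonneg h2 (mul_nonneg hsq hXY)]
  -- the two one-sided inequalities
  have hup : ∑ e, C e ≤ ∑ e, (B e - A e) := by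
    have h : ∑ e, (A e - B e + C e) ≤ 0 := by
      refine le_of_eq_of_le (Finset.sum_congr rfl fun e _ => ?_) hm
      simp only [hA, hB, hC]
      ring
    have h' : ∑ e, (A e - B e + C e) = ∑ e, C e - ∑ e, (B e - A e) := by
      rw [← Finset.sum_sub_distrib]
      exact Finset.sum_congr rfl fun e _ => by ring
    linarith
  have hlow : ∑ e, (A e + B e) ≤ ∑ e, C e := by
    have h : ∑ e, (A e + B e - C e) ≤ 0 := by
      refine le_of_eq_of_le (Finset.sum_congr rfl fun e _ => ?_) hp
      simp only [hA, hB, hC]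
    have h' : ∑ e, (A e + B e - C e) = ∑ e, (A e + B e) - ∑ e, C e := Finset.sum_sub_distrib _ _
    linarith
  have hbound : ∑ e, (|A e| + |B e|) ≤
      K * ∑ e, ((φ (s e) - φ (t e)) ^ 2 + (ψ (s e) - ψ (t e)) ^ 2) := by
    rw [Finset.mul_sum]
    exact Finset.sum_le_sum fun e _ => hpt e
  have hup' : ∑ e, (B e - A e) ≤ ∑ e, (|A e| + |B e|) :=
    Finset.sum_le_sum fun e _ => by
      have := neg_abs_le (A e); have := le_abs_self (B e); linarith
  have hlow' : -∑ e, (|A e| + |B e|) ≤ ∑ e, (A e + B e) := by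
    rw [← Finset.sum_neg_distrib]
    exact Finset.sum_le_sum fun e _ => by
      have := neg_abs_le (A e); have := neg_abs_le (B e); linarith
  exact abs_le.2 ⟨by linarith, by linarith⟩

end Algebra


/-! ### Lattice bookkeeping: the time-zero spatial edges of the torus -/

section Lattice

/-- The time-zero spatial edges of the torus `(ℤ/L)^4` are `((0, y), j+1)`, `y ∈ (ℤ/L)^3`,
`j : Fin 3`: re-indexing of the slice sum. [folklore] -/
theorem sum_edge_slice_eq {L : ℕ} [NeZero L] {M : Type*} [AddCommMonoid M] (f : Edge 4 L → M) :
    (∑ e : Edge 4 L, if e.1 0 = 0 ∧ e.2 ≠ 0 then f e else 0) =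
      ∑ q : (Fin 3 → ZMod L) × Fin 3, f (Fin.cons 0 q.1, q.2.succ) := by
  classical
  set ι : (Fin 3 → ZMod L) × Fin 3 → Edge 4 L := fun q => (Fin.cons 0 q.1, q.2.succ) with hι
  have hinj : Function.Injective ι := by
    intro q q' h
    simp only [hι, Prod.mk.injEq] at h
    exact Prod.ext (Fin.cons_right_injective _ h.1) (Fin.succ_injective _ h.2)
  have hset : (Finset.univ.filter fun e : Edge 4 L => e.1 0 = 0 ∧ e.2 ≠ 0) =
      Finset.univ.image ι := by
    ext e
    simp only [Finset.mem_filter, Finset.mem_univ, true_and, Finset.mem_image]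
    constructor
    · rintro ⟨h0, hne⟩
      refine ⟨(Fin.tail e.1, e.2.pred hne), ?_⟩
      simp only [hι, Fin.succ_pred]
      ext
      · simp only
        conv_rhs => rw [← Fin.cons_self_tail e.1, h0]
      · rfl
    · rintro ⟨q, rfl⟩
      exact ⟨rfl, Fin.succ_ne_zero _⟩
  rw [← Finset.sum_filter, hset, Finset.sum_image fun q _ q' _ h => hinj h]

end Lattice

end CoulombFP

end Literature.MathematicalPhysics.QuantumFieldTheory

end
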